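/-
Copyright: statement-level skeleton of a published paper (lit-balaban cell, Phase-2 proof seat p39 gen 11). No proof claims
beyond what the kernel checks below.
-/
import Literature.MathematicalPhysics.QuantumFieldTheory.Balaban1983to89.B3Eq329WardVanishing
import Literature.MathematicalPhysics.QuantumFieldTheory.Balaban1983to89.B3CxiPropagator

/-!
# B3 — T. Bałaban, *(Higgs)₂,₃ quantum fields in a finite volume. III. Renormalization*, CMP **88** (1983) 411–445
[Balaban1983Higgs3], (2.26) p. 431 [PDF 21] and p. 442 [PDF 32]: **the Ward–Takahashi identity (2.26) AT FREE BOUNDARY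
CONDITIONS** — on the infinite lattice `ηℤ^d` with the infinite-volume propagator `C^η_{M²}` — PROVED for every `d`, every
spacing `η > 0`, every mass `M² > 0`, every bond `b` and every test function `λ` of polynomial growth; and, ALONG THE PRINTED
ROUTE of p. 442, the vanishing of the one-loop vector self-energy kernel `Π^{(ξ)}_{μμ′}` of the square bracket of (3.29)
*"because it has exactly the form appearing in (2.26) with M² = 1"*

statement-level skeleton of published theorems with citation tags; proofs where landed; nothing here is a claim about
the Yang–Mills mass gap

PDF held: `paper:balaban1983-higgs-2-3-quantum-fields-finite-volume` (journal page = PDF page + 410); pp. 430–431 [PDF 20–21]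
and pp. 441–442 [PDF 31–32] read on the ×2 renders `run/shared/lean/pub/pub-balaban/b2b-balaban-ref1/pages/1983-cmp88-higgs23-III/
1983-cmp88-higgs23-III-p020-x2.png`, `-p021-x2.png`, `-p031-x2.png`, `-p032-x2.png` (never the OCR layer alone).

CITATION HEADER (lean-in-tree rule).  Part of the lit-balaban TYPED SKELETON (HOME `run/shared/lean/pub/lit-balaban/`), PHASE 2,
proof seat p39 (generation 11).  WHAT IS REPRODUCED: rows **B3.Eq2.26-2.28** (*"(2.26) … free b.c. as limits of periodic"*) and
**B3.Eq3.25-3.32** (the p. 442 WT-vanishing sentence) of `HOME/lit-balaban-r15/ROWS-B3.md` (fold owner r15).  Companions: this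
seat's gen-2/3 torus files `B3WT223Instance` … `B3WT226Traces` ((2.23)–(2.26) on the FINITE torus for the concrete lattice
Gaussian model: `B3WT226Traces.eq226`, kernels `kerCD`/`kerDCD`, terms `term1`–`term4`), r15's `B3Sect3VectorSelfEnergy` §6 /
`B3CxiPropagator` (the infinite ξ-lattice `ZSite`, `pdiffZ`/`pdiffAdjZ`, the free propagator `Cxi` with its lattice equation
`negLapZ_Cxi_add` and polynomially weighted summability `summable_weight_Cxi`), and p20's `B3Eq329WardVanishing` (`Pi2Z`, the
kernel of the square bracket of (3.29); `Pi2Z_Cxi_eq_zero` proved there by Parseval on `T^d`).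

THE PRINTED TEXT (verbatim).  p. 431 [PDF 21]: *"Taking F = 1, differentiating with respect to A and next taking A = 0 and
using the identity (2.25), we get*
`∫dμ_{C^η_{M²}}(φ)[(−e_k⟨∂^ηφ, Aqφ⟩)(:⟨∂^ηφ, ∂^ηλqφ⟩:) − e_k⟨φ, A·∂^ηλq²φ⟩ − e_k⟨∂^ηφ, ηA∂^ηλq²φ⟩]`
`= −e_k Σ_{b,b′} η^{2d}A_b tr q(C^η_{M²}∂^{η*})(b₋,b′)q(C^η_{M²}∂^{η*})(b′₋,b)(∂^ηλ)(b′) + e_k Σ_{b,b′} η^{2d}A_b tr qC^η_{M²}(b₋,b′₋)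
q(∂^ηC^η_{M²}∂^{η*})(b′,b)(∂^ηλ)(b′) − e_k Σ_b η^dA_b(∂^ηλ)(b) tr q²C^η_{M²}(0) − e_k Σ_b η^dηA_b(∂^ηλ)(b) tr q²(C^η_{M²}∂^η)(b₋,b)
= 0, (2.26)"* … *"Taking other functions F, or differentiating (2.24) to higher order in A, we can get all necessary
Ward-Takahashi identities. They hold for free boundary conditions also by taking a limit of the identities with periodic
boundary conditions."*  p. 442 [PDF 32]: *"Now if we introduce the function λ(y′) = Σ_{μ′=1}^d g′(y)A′_{μ′}(y)(y′_{μ′} − y_{μ′}),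
then (∂^ξ_{μ′}λ)(y′) = g′(y)A′_{μ′}(y), and the expression in the square bracket above has exactly the form appearing in the
Ward-Takahashi identity (2.26) with M² = 1, hence it is equal to 0."*

WHAT IS TYPED / PROVED, and how (`d` arbitrary; sites of `ηℤ^d` in integer coordinates `ZSite d`, spacing `η > 0`,
`c = η⁻¹`; a bond `b = (x, μ)` has `b₋ = x`, `b₊ = x + e_μ`; translation-invariant two-point kernels `C(y, z) = C(y − z)`).
* §1 the printed kernels of the RIGHT member of (2.26), in the conventions of the torus file `B3WT226Traces` transcribed to
  `ℤ^d`: `kerCDZ` = `(C∂^{η*})(y, b) := c(C(y,b₊) − C(y,b₋))`, `kerDCDZ` = `(∂^ηC∂^{η*})(b′,b) := c²(C(b′₊,b₊) − C(b′₊,b₋) −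
  C(b′₋,b₊) + C(b′₋,b₋))`, and, for ONE bond `b = (x, μ)` (the identity is linear in the external leg `A`, so it is the
  family of its per-bond identities), the four printed terms without their common factor `−e_kη^dA_b tr q²`: `wt1` (the
  `b′`-sum `Σ_{b′}η^d(C∂^{η*})(b₋,b′)(C∂^{η*})(b′₋,b)(∂^ηλ)(b′)`, a `tsum` over `b′₋ ∈ ℤ^d` of the finite sum over the
  direction of `b′`), `wt2`, `wt3` (`(∂^ηλ)(b)C(0)`), `wt4` (`η(∂^ηλ)(b)(C∂^η)(b₋,b)`); `tr q(X)q(Y) = XY·tr q²` for the scalar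
  kernels, as in the torus file.
* §2–§4 lattice calculus on `ℤ^d` against test functions of POLYNOMIAL GROWTH `|λ(z)| ≤ A(1 + |z|₁)^m` (the p. 442 use has a
  LINEAR `λ`): summation by parts `Σ_u f(u)(∂_νg)(u) = Σ_u (∂^*_νf)(u)g(u)` under the two summability hypotheses it needs, the
  weights `(1 + |u + a|₁) ≤ (1 + |u|₁)(1 + |a|₁)`, summability of (translate of `C`) × (translate of `C`) × (translate of `λ`)
  from `Σ_z(1 + |z|₁)^m|C(z)| < ∞`.
* §5 **`bracket226_eq_zero`** — (2.26) AT FREE BOUNDARY CONDITIONS, per bond: for every EVEN kernel `C` on `ℤ^d` satisfying the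
  lattice equation `(−Δ^η + M²)C = δ^η` (`negLapZ η C + M²C = η^{−d}1_{0}`, any real `M²`) and `Σ_z(1 + |z|₁)^m|C(z)| < ∞`, and
  every `λ` with `|λ(z)| ≤ A(1 + |z|₁)^m`:  `−wt1 + wt2 − wt3 − wt4 = 0` at every bond `(x, μ)`, all four `b′`-sums converging
  absolutely.  THE PROOF (ours — the print proves (2.26) on the torus by the Gaussian integration (2.23)–(2.25), as this seat's
  `B3WT226Traces.eq226` does, and passes to free boundary conditions *"by taking a limit"*; we prove the free-boundary identity
  DIRECTLY, a shorter road on `ℤ^d`, and do NOT replay the limit): with `u = b′₋ − x`, `B_μ(u) = c(C(u − e_μ) − C(u))` and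
  `W_ν(u) = c(C(u)B_μ(u + e_ν) − C(u + e_ν)B_μ(u))`, evenness gives `−wt1 + wt2 = Σ_uη^dΣ_νW_ν(u)(∂_νΛ)(u)` (`Λ = λ(x + ·)`);
  summation by parts and `Σ_ν∂^*_νW_ν = c²(B_μ·HC − C·HB_μ)` (`H` = nearest-neighbour sum, `B3CxiPropagator.hop`); the lattice
  equations of `C` and of `B_μ` (`c²HC = (2dc² + M²)C − δ^η`, `c²HB_μ = (2dc² + M²)B_μ − c(δ^η(· − e_μ) − δ^η)`) leave only
  `δ`-terms: `−wt1 + wt2 = C(e_μ)(∂^η_μλ)(x) = wt3 + wt4`.  **`eq226_free`**: the printed four-term display, summed against any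
  finitely supported external leg `A_b` with the factors `−e_k`, `η^d`, `tr q²`, `= 0`.
* §6 THE PROPAGATORS: `C^η_{M²} := M^{d−2}·C^{ηM}` (`CetaM`, r15's momentum-integral `Cxi` at spacing `ηM`; `CetaM η 1 = Cxi η`)
  IS even, solves `(−Δ^η + M²)C^η_{M²} = δ^η` (`negLapZ_CetaM_add`) and is polynomially-weighted summable; hence
  **`bracket226_CetaM_eq_zero` / `eq226_free_CetaM`**: (2.26) at free boundary conditions for `C^η_{M²}`, every `η > 0`, `M² > 0`,
  and **`bracket226_Cxi_eq_zero`** (`M² = 1`).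
* §7 THE p. 442 ROUTE: for the linear `λ(y′) = ξ·y′_{μ′}` one has `(∂^ξ_νλ) ≡ δ_{νμ′}` and p20's kernel is LITERALLY the
  per-bond bracket, `Pi2Z d ξ τ C μ μ′ y = τ·(−wt1 + wt2 − wt3 − wt4)` at the bond `(y, μ)` (`Pi2Z_eq_bracket226`); hence
  **`Pi2Z_eq_zero_of_latticeEq`** (every admissible `C`, any `M²`), **`Pi2Z_CetaM_eq_zero`**, and **`Pi2Z_Cxi_eq_zero_via226`** —
  *"exactly the form appearing in the Ward-Takahashi identity (2.26) with M² = 1, hence it is equal to 0"* — a second,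
  independent proof of p20's `B3Eq329WardVanishing.Pi2Z_Cxi_eq_zero` (there: Parseval on `T^d` and the zero-momentum Ward
  identity), here by the position-space identity the print invokes.
* §8 (v1.1, append-only) **`CetaM_eq_integral`**: `C^η_{M²}(z) = (2π)^{−d}∫_{|p_μ|≤π/η} cos(ηp·z)/(Δ^η(p) + M²) dp` — the
  definition by rescaling IS the printed infinite-volume momentum-integral propagator (change of variables `p = p′/M` via r15's
  `integral_bzBox_comp_smul`, `lapSymbol_eq_smul`).  v1.1 also corrects the page numeral of seven `(3.29)` citation tags
  (`p.442 → p.441`: the display (3.29) is printed on p. 441, the sentence it serves on p. 442; CITELOC class, docstrings only);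
  every v1 declaration is otherwise byte-identical.
HONEST SCOPE: the LEFT member of (2.26) (the Gaussian integral) is not re-typed on `ℤ^d` (no Gaussian measure on the infinite
lattice is constructed; the torus instance is `B3WT226Traces.eq226_wick`); the printed limit *"of the identities with periodic
boundary conditions"* is not formalized (the free-boundary identity is proved directly); (2.27)/(2.28) (pictures, the `:φ⁴:`
identity) are not typed; `C^η_{M²}` is the momentum-integral propagator rescaled from r15's `Cxi` (uniqueness among decaying
solutions of the lattice equation is not claimed).  Mathlib + the cited tree files only; definitions with bodies and
theorems, no named fact (`def … : Prop`), no `sorry`; standard axioms.  Unit `lit-balaban-p39-g11` (Phase-2 proof seat p39,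
gen 11), HOME `run/shared/lean/pub/lit-balaban/`, 2026-08-22.
-/

open scoped BigOperators
open Finset Filter

namespace Literature.MathematicalPhysics.QuantumFieldTheory.Balaban1983to89.B3WT226FreeLattice

open B3Sect3VectorSelfEnergy B3CxiPropagator B3Eq329WardVanishing

noncomputable section

variable {d : ℕ}

/-! ## §1 The printed kernels and the four printed terms of (2.26), per bond, on `ηℤ^d` -/

/-- `(C^η_{M²}∂^{η*})(y, b) = (C^η_{M²}∂^η)(y, b) := c(C(y, b₊) − C(y, b₋))`, `b = (x, μ)`, `b₋ = x`, `b₊ = x + e_μ`, for a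
translation-invariant kernel `C(y, z) = C(y − z)` on `ℤ^d` (the torus file's `B3WT226Traces.kerCD`). [cite: Balaban1983Higgs3, (2.26) p.431] -/
def kerCDZ (c : ℝ) (C : ZSite d → ℝ) (y x : ZSite d) (μ : Fin d) : ℝ :=
  c * (C (y - (x + unitVec μ)) - C (y - x))

/-- `(∂^ηC^η_{M²}∂^{η*})(b′, b) := c²(C(b′₊, b₊) − C(b′₊, b₋) − C(b′₋, b₊) + C(b′₋, b₋))`, `b′ = (x′, ν)`, `b = (x, μ)` (the torus
file's `B3WT226Traces.kerDCD`). [cite: Balaban1983Higgs3, (2.26) p.431] -/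
def kerDCDZ (c : ℝ) (C : ZSite d → ℝ) (x' : ZSite d) (ν : Fin d) (x : ZSite d) (μ : Fin d) : ℝ :=
  c ^ 2 * (C ((x' + unitVec ν) - (x + unitVec μ)) - C ((x' + unitVec ν) - x) - C (x' - (x + unitVec μ)) + C (x' - x))

/-- first printed term of (2.26) at the bond `b = (x, μ)`, without the common factor `−e_kη^dA_b tr q²`:
`Σ_{b′} η^d (C∂^{η*})(b₋, b′)(C∂^{η*})(b′₋, b)(∂^ηλ)(b′)` — the `b′`-sum a `tsum` over `b′₋ ∈ ℤ^d` of the sum over the direction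
of `b′` (free boundary conditions: the infinite lattice). [cite: Balaban1983Higgs3, (2.26) p.431] -/
def wt1 (η : ℝ) (C lam : ZSite d → ℝ) (x : ZSite d) (μ : Fin d) : ℝ :=
  ∑' x' : ZSite d, η ^ d * ∑ ν : Fin d, kerCDZ η⁻¹ C x x' ν * kerCDZ η⁻¹ C x' x μ * pdiffZ η⁻¹ ν lam x'

/-- second printed term of (2.26) at the bond `b = (x, μ)`, without the common factor `+e_kη^dA_b tr q²`:
`Σ_{b′} η^d C(b₋, b′₋)(∂^ηC∂^{η*})(b′, b)(∂^ηλ)(b′)`. [cite: Balaban1983Higgs3, (2.26) p.431] -/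
def wt2 (η : ℝ) (C lam : ZSite d → ℝ) (x : ZSite d) (μ : Fin d) : ℝ :=
  ∑' x' : ZSite d, η ^ d * ∑ ν : Fin d, C (x - x') * kerDCDZ η⁻¹ C x' ν x μ * pdiffZ η⁻¹ ν lam x'

/-- third printed term of (2.26) at the bond `b = (x, μ)`, without the common factor `−e_kη^dA_b tr q²`: `(∂^ηλ)(b)·C^η_{M²}(0)`.
[cite: Balaban1983Higgs3, (2.26) p.431] -/
def wt3 (η : ℝ) (C lam : ZSite d → ℝ) (x : ZSite d) (μ : Fin d) : ℝ :=
  pdiffZ η⁻¹ μ lam x * C 0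

/-- fourth printed term of (2.26) at the bond `b = (x, μ)`, without the common factor `−e_kη^dA_b tr q²`:
`η(∂^ηλ)(b)·(C^η_{M²}∂^η)(b₋, b)`. [cite: Balaban1983Higgs3, (2.26) p.431] -/
def wt4 (η : ℝ) (C lam : ZSite d → ℝ) (x : ZSite d) (μ : Fin d) : ℝ :=
  η * pdiffZ η⁻¹ μ lam x * kerCDZ η⁻¹ C x x μ

/-- the per-bond right member of (2.26) without the common factor `e_kη^dA_b tr q²`: `−wt1 + wt2 − wt3 − wt4` (the signs of
the four printed terms). [cite: Balaban1983Higgs3, (2.26) p.431] -/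
def bracket226 (η : ℝ) (C lam : ZSite d → ℝ) (x : ZSite d) (μ : Fin d) : ℝ :=
  -wt1 η C lam x μ + wt2 η C lam x μ - wt3 η C lam x μ - wt4 η C lam x μ

/-! ## §2 Elementary lattice calculus on `ℤ^d`: unit vectors, the `ℓ¹` size, weights -/

/-- kernel: the `μ′`-coordinate of `e_ν`. [cite: Balaban1983Higgs3, (2.26) p.431] -/
theorem unitVec_apply (ν μ' : Fin d) : (unitVec ν : ZSite d) μ' = if μ' = ν then 1 else 0 := by
  simp [unitVec, Pi.single_apply]

/-- kernel: `e_μ ≠ 0`. [cite: Balaban1983Higgs3, (2.26) p.431] -/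
theorem unitVec_ne_zero (μ : Fin d) : (unitVec μ : ZSite d) ≠ 0 := by
  intro h
  have := congrArg (fun v : ZSite d => v μ) h
  simp [unitVec] at this

/-- kernel: `|−y|₁ = |y|₁`. [cite: Balaban1983Higgs3, (2.26) p.431] -/
theorem l1_neg (y : ZSite d) : l1 (-y) = l1 y := by
  simp [l1]

/-- kernel: `|a + b|₁ ≤ |a|₁ + |b|₁`. [cite: Balaban1983Higgs3, (2.26) p.431] -/
theorem l1_add_le (a b : ZSite d) : l1 (a + b) ≤ l1 a + l1 b := by
  unfold l1
  rw [← Finset.sum_add_distrib]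
  exact Finset.sum_le_sum fun μ _ => by simpa using Int.natAbs_add_le (a μ) (b μ)

/-- kernel: `|e_μ|₁ = 1`. [cite: Balaban1983Higgs3, (2.26) p.431] -/
theorem l1_unitVec (μ : Fin d) : l1 (unitVec μ : ZSite d) = 1 := by
  unfold l1
  rw [Finset.sum_eq_single μ]
  · simp [unitVec]
  · intro ν _ hν; simp [unitVec, hν]
  · intro h; exact absurd (Finset.mem_univ μ) h

/-- kernel: one coordinate is bounded by the `ℓ¹` size, `|y_μ| ≤ |y|₁`. [cite: Balaban1983Higgs3, (2.26) p.431] -/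
theorem abs_coord_le_l1 (y : ZSite d) (μ : Fin d) : |(y μ : ℝ)| ≤ (l1 y : ℝ) := by
  have h : (y μ).natAbs ≤ l1 y := by
    unfold l1
    exact Finset.single_le_sum (f := fun ν => (y ν).natAbs) (fun _ _ => Nat.zero_le _) (Finset.mem_univ μ)
  calc |(y μ : ℝ)| = ((y μ).natAbs : ℝ) := by rw [← Int.cast_abs, Int.abs_eq_natAbs, Int.cast_natCast]
    _ ≤ (l1 y : ℝ) := by exact_mod_cast h

/-- kernel: the weight of a translate, `1 + |u + a|₁ ≤ (1 + |u|₁)(1 + |a|₁)`. [cite: Balaban1983Higgs3, (2.26) p.431] -/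
theorem weight_add_le (u a : ZSite d) : (1 + (l1 (u + a) : ℝ)) ≤ (1 + (l1 u : ℝ)) * (1 + (l1 a : ℝ)) := by
  have h : (l1 (u + a) : ℝ) ≤ (l1 u : ℝ) + (l1 a : ℝ) := by exact_mod_cast l1_add_le u a
  have hu : (0 : ℝ) ≤ l1 u := Nat.cast_nonneg _
  have ha : (0 : ℝ) ≤ l1 a := Nat.cast_nonneg _
  nlinarith

/-- kernel: the weight of a translate, power form, `(1 + |u + a|₁)^m ≤ (1 + |u|₁)^m(1 + |a|₁)^m`. [cite: Balaban1983Higgs3, (2.26) p.431] -/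
theorem weight_pow_add_le (u a : ZSite d) (m : ℕ) :
    (1 + (l1 (u + a) : ℝ)) ^ m ≤ (1 + (l1 u : ℝ)) ^ m * (1 + (l1 a : ℝ)) ^ m := by
  rw [← mul_pow]
  exact pow_le_pow_left₀ (by positivity) (weight_add_le u a) m

/-- kernel: `1 ≤ (1 + |u|₁)^m`. [cite: Balaban1983Higgs3, (2.26) p.431] -/
theorem one_le_weight_pow (u : ZSite d) (m : ℕ) : (1 : ℝ) ≤ (1 + (l1 u : ℝ)) ^ m :=
  one_le_pow₀ (by have : (0:ℝ) ≤ l1 u := Nat.cast_nonneg _; linarith)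


/-! ## §3 Summation by parts on `ℤ^d` and summability against polynomially growing test functions -/

/-- kernel (summation by parts on `ℤ^d`, two-hypothesis form): `Σ_u f(u)(∂_νg)(u) = Σ_u (∂^*_νf)(u)g(u)` as soon as
`u ↦ f(u)g(u + e_ν)` and `u ↦ f(u)g(u)` are summable — no boundedness of `g` required (the test functions of (2.26) on the
infinite lattice grow linearly in the p. 442 application). [cite: Balaban1983Higgs3, (2.26) p.431] -/
theorem tsum_mul_pdiffZ {f g : ZSite d → ℝ} (c : ℝ) (ν : Fin d)
    (h1 : Summable fun u => f u * g (u + unitVec ν)) (h2 : Summable fun u => f u * g u) :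
    ∑' u, f u * pdiffZ c ν g u = ∑' u, pdiffAdjZ c ν f u * g u := by
  have h3 : Summable fun u => f (u - unitVec ν) * g u := by
    refine (Equiv.summable_iff (Equiv.addRight (unitVec ν))).mp ?_
    simpa only [Function.comp_def, Equiv.coe_addRight, add_sub_cancel_right] using h1
  have key : ∑' u, f (u - unitVec ν) * g u = ∑' u, f u * g (u + unitVec ν) := by
    rw [← Equiv.tsum_eq (Equiv.addRight (unitVec ν)) (fun u => f (u - unitVec ν) * g u)]
    simp only [Equiv.coe_addRight, add_sub_cancel_right]
  calc ∑' u, f u * pdiffZ c ν g u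
      = ∑' u, (c * (f u * g (u + unitVec ν)) - c * (f u * g u)) := tsum_congr fun u => by simp only [pdiffZ]; ring
    _ = c * ∑' u, f u * g (u + unitVec ν) - c * ∑' u, f u * g u := by
        rw [(h1.mul_left c).tsum_sub (h2.mul_left c), tsum_mul_left, tsum_mul_left]
    _ = c * ∑' u, f (u - unitVec ν) * g u - c * ∑' u, f u * g u := by rw [key]
    _ = ∑' u, (c * (f (u - unitVec ν) * g u) - c * (f u * g u)) := by
        rw [(h3.mul_left c).tsum_sub (h2.mul_left c), tsum_mul_left, tsum_mul_left]
    _ = ∑' u, pdiffAdjZ c ν f u * g u := tsum_congr fun u => by simp only [pdiffAdjZ]; ring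

section Weighted

variable {m : ℕ} {C : ZSite d → ℝ}

/-- kernel: a polynomially-weighted summable kernel is bounded by its weighted `ℓ¹` norm. [cite: Balaban1983Higgs3, (2.26) p.431] -/
theorem abs_le_wsum (hC : Summable fun z => (1 + (l1 z : ℝ)) ^ m * |C z|) (z : ZSite d) :
    |C z| ≤ ∑' w, (1 + (l1 w : ℝ)) ^ m * |C w| := by
  calc |C z| ≤ (1 + (l1 z : ℝ)) ^ m * |C z| := le_mul_of_one_le_left (abs_nonneg _) (one_le_weight_pow z m)
    _ ≤ ∑' w, (1 + (l1 w : ℝ)) ^ m * |C w| :=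
        hC.le_tsum z fun w _ => mul_nonneg (by positivity) (abs_nonneg _)

/-- kernel: the weighted `ℓ¹` norm is nonnegative. [cite: Balaban1983Higgs3, (2.26) p.431] -/
theorem wsum_nonneg (C : ZSite d → ℝ) (m : ℕ) : 0 ≤ ∑' w, (1 + (l1 w : ℝ)) ^ m * |C w| :=
  tsum_nonneg fun w => mul_nonneg (by positivity) (abs_nonneg _)

/-- kernel: translates of a polynomially-weighted summable kernel are polynomially-weighted summable (weight of a translate
`≤ (1 + |a|₁)^m ×` weight). [cite: Balaban1983Higgs3, (2.26) p.431] -/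
theorem summable_weight_shift (hC : Summable fun z => (1 + (l1 z : ℝ)) ^ m * |C z|) (a : ZSite d) :
    Summable fun u => (1 + (l1 u : ℝ)) ^ m * |C (u + a)| := by
  have hs : Summable fun u => (1 + (l1 (u + a) : ℝ)) ^ m * |C (u + a)| :=
    (Equiv.summable_iff (Equiv.addRight a) (f := fun z => (1 + (l1 z : ℝ)) ^ m * |C z|)).mpr hC
  refine (hs.mul_left ((1 + (l1 (-a) : ℝ)) ^ m)).of_nonneg_of_le (fun u => mul_nonneg (by positivity) (abs_nonneg _))
    fun u => ?_
  have hw : (1 + (l1 u : ℝ)) ^ m ≤ (1 + (l1 (u + a) : ℝ)) ^ m * (1 + (l1 (-a) : ℝ)) ^ m := by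
    have := weight_pow_add_le (u + a) (-a) m
    rwa [add_neg_cancel_right] at this
  calc (1 + (l1 u : ℝ)) ^ m * |C (u + a)| ≤ (1 + (l1 (u + a) : ℝ)) ^ m * (1 + (l1 (-a) : ℝ)) ^ m * |C (u + a)| :=
        mul_le_mul_of_nonneg_right hw (abs_nonneg _)
    _ = (1 + (l1 (-a) : ℝ)) ^ m * ((1 + (l1 (u + a) : ℝ)) ^ m * |C (u + a)|) := by ring

/-- kernel: the growth constant of a polynomially growing test function is nonnegative (`|λ(0)| ≤ A`). [cite: Balaban1983Higgs3, (2.26) p.431] -/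
theorem growth_const_nonneg {lam : ZSite d → ℝ} {A : ℝ} (hlam : ∀ z, |lam z| ≤ A * (1 + (l1 z : ℝ)) ^ m) : 0 ≤ A := by
  have h := hlam 0
  simp only [l1, Pi.zero_apply, Int.natAbs_zero, Finset.sum_const_zero, Nat.cast_zero, add_zero, one_pow,
    mul_one] at h
  exact (abs_nonneg _).trans h

/-- kernel: (translate of `C`) × (translate of a polynomially growing `λ`) is summable: `Σ_u |C(u + a)||λ(x + u + e)| < ∞`.
[cite: Balaban1983Higgs3, (2.26) p.431] -/
theorem summable_absC_mul_absLam (hC : Summable fun z => (1 + (l1 z : ℝ)) ^ m * |C z|) {lam : ZSite d → ℝ} {A : ℝ}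
    (hlam : ∀ z, |lam z| ≤ A * (1 + (l1 z : ℝ)) ^ m) (x a e : ZSite d) :
    Summable fun u => |C (u + a)| * |lam (x + u + e)| := by
  have hA := growth_const_nonneg hlam
  refine ((summable_weight_shift hC a).mul_left (A * (1 + (l1 (x + e) : ℝ)) ^ m)).of_nonneg_of_le
    (fun u => mul_nonneg (abs_nonneg _) (abs_nonneg _)) fun u => ?_
  have h1 : |lam (x + u + e)| ≤ A * ((1 + (l1 u : ℝ)) ^ m * (1 + (l1 (x + e) : ℝ)) ^ m) := by
    calc |lam (x + u + e)| ≤ A * (1 + (l1 (x + u + e) : ℝ)) ^ m := hlam _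
      _ ≤ A * ((1 + (l1 u : ℝ)) ^ m * (1 + (l1 (x + e) : ℝ)) ^ m) := by
          refine mul_le_mul_of_nonneg_left ?_ hA
          have := weight_pow_add_le u (x + e) m
          rwa [show u + (x + e) = x + u + e by abel] at this
  calc |C (u + a)| * |lam (x + u + e)| ≤ |C (u + a)| * (A * ((1 + (l1 u : ℝ)) ^ m * (1 + (l1 (x + e) : ℝ)) ^ m)) :=
        mul_le_mul_of_nonneg_left h1 (abs_nonneg _)
    _ = A * (1 + (l1 (x + e) : ℝ)) ^ m * ((1 + (l1 u : ℝ)) ^ m * |C (u + a)|) := by ring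

/-- kernel: `C(u + a)C(u + b)λ(x + u + e)` is summable in `u` (one factor bounded by the weighted norm, the other pair by
`summable_absC_mul_absLam`). [cite: Balaban1983Higgs3, (2.26) p.431] -/
theorem summable_CC_lam (hC : Summable fun z => (1 + (l1 z : ℝ)) ^ m * |C z|) {lam : ZSite d → ℝ} {A : ℝ}
    (hlam : ∀ z, |lam z| ≤ A * (1 + (l1 z : ℝ)) ^ m) (x a b e : ZSite d) :
    Summable fun u => C (u + a) * C (u + b) * lam (x + u + e) := by
  set S := ∑' w, (1 + (l1 w : ℝ)) ^ m * |C w|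
  refine Summable.of_norm_bounded ((summable_absC_mul_absLam hC hlam x b e).mul_left S) fun u => ?_
  rw [Real.norm_eq_abs, abs_mul, abs_mul]
  calc |C (u + a)| * |C (u + b)| * |lam (x + u + e)| ≤ S * |C (u + b)| * |lam (x + u + e)| := by
        gcongr
        exact abs_le_wsum hC _
    _ = S * (|C (u + b)| * |lam (x + u + e)|) := by ring

end Weighted

/-! ## §4 The change of variables `u = b′₋ − x`, the kernel `W_ν`, and the lattice equations in nearest-neighbour form -/

/-- the kernel `W_ν(u) = c(C(u)B_μ(u + e_ν) − C(u + e_ν)B_μ(u))`, `B_μ = ∂^{η*}_μC` (`pdiffAdjZ`), whose pairing with `∂_νΛ`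
is `−wt1 + wt2` after the change of variables `u = b′₋ − x`. [cite: Balaban1983Higgs3, (2.26) p.431] -/
def Wker (c : ℝ) (C : ZSite d → ℝ) (μ ν : Fin d) (u : ZSite d) : ℝ :=
  c * (C u * pdiffAdjZ c μ C (u + unitVec ν) - C (u + unitVec ν) * pdiffAdjZ c μ C u)

section Algebra

variable (c : ℝ) (C lam : ZSite d → ℝ) (x : ZSite d) (μ : Fin d)

/-- kernel: `(C∂^{η*})(b₋, b′) = (∂^η_νC)(u)` for `b′ = (x + u, ν)`, `b₋ = x`, `C` even. [cite: Balaban1983Higgs3, (2.26) p.431] -/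
theorem kerCDZ_left (hC : ∀ z, C (-z) = C z) (u : ZSite d) (ν : Fin d) :
    kerCDZ c C x (x + u) ν = pdiffZ c ν C u := by
  simp only [kerCDZ, pdiffZ]
  rw [show x - (x + u + unitVec ν) = -(u + unitVec ν) by abel, show x - (x + u) = -u by abel, hC, hC]

/-- kernel: `(C∂^{η*})(b′₋, b) = (∂^{η*}_μC)(u)` for `b′₋ = x + u`, `b = (x, μ)`. [cite: Balaban1983Higgs3, (2.26) p.431] -/
theorem kerCDZ_right (u : ZSite d) : kerCDZ c C (x + u) x μ = pdiffAdjZ c μ C u := by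
  simp only [kerCDZ, pdiffAdjZ]
  rw [show x + u - (x + unitVec μ) = u - unitVec μ by abel, show x + u - x = u by abel]

/-- kernel: `C(b₋, b′₋) = C(u)` for `b′₋ = x + u`, `C` even. [cite: Balaban1983Higgs3, (2.26) p.431] -/
theorem C_left (hC : ∀ z, C (-z) = C z) (u : ZSite d) : C (x - (x + u)) = C u := by
  rw [show x - (x + u) = -u by abel, hC]

/-- kernel: `(∂^ηC∂^{η*})(b′, b) = (∂^η_ν∂^{η*}_μC)(u)` for `b′ = (x + u, ν)`, `b = (x, μ)`. [cite: Balaban1983Higgs3, (2.26) p.431] -/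
theorem kerDCDZ_eq (u : ZSite d) (ν : Fin d) : kerDCDZ c C (x + u) ν x μ = pdiffZ c ν (pdiffAdjZ c μ C) u := by
  simp only [kerDCDZ, pdiffZ, pdiffAdjZ]
  rw [show x + u + unitVec ν - (x + unitVec μ) = u + unitVec ν - unitVec μ by abel,
    show x + u + unitVec ν - x = u + unitVec ν by abel, show x + u - (x + unitVec μ) = u - unitVec μ by abel,
    show x + u - x = u by abel]
  ring

/-- kernel: `(∂^ηλ)(b′) = (∂^η_νΛ)(u)` with `Λ = λ(x + ·)`. [cite: Balaban1983Higgs3, (2.26) p.431] -/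
theorem pdiffZ_shift (u : ZSite d) (ν : Fin d) :
    pdiffZ c ν lam (x + u) = pdiffZ c ν (fun v => lam (x + v)) u := by
  simp only [pdiffZ, add_assoc]

/-- kernel: the integrand identity `−(∂_νC)(u)B_μ(u) + C(u)(∂_νB_μ)(u) = W_ν(u)` (the `C(u)B_μ(u)` terms cancel).
[cite: Balaban1983Higgs3, (2.26) p.431] -/
theorem integrand_eq_Wker (u : ZSite d) (ν : Fin d) :
    -(pdiffZ c ν C u * pdiffAdjZ c μ C u) + C u * pdiffZ c ν (pdiffAdjZ c μ C) u = Wker c C μ ν u := by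
  simp only [Wker, pdiffZ]
  ring

/-- kernel: the nearest-neighbour sum of `B_μ = ∂^{η*}_μC` is `c(HC(· − e_μ) − HC)`. [cite: Balaban1983Higgs3, (2.26) p.431] -/
theorem hop_pdiffAdjZ (u : ZSite d) :
    hop (pdiffAdjZ c μ C) u = c * (hop C (u - unitVec μ) - hop C u) := by
  simp only [hop, pdiffAdjZ]
  rw [← Finset.sum_sub_distrib, Finset.mul_sum]
  refine Finset.sum_congr rfl fun ν _ => ?_
  rw [show u + unitVec ν - unitVec μ = u - unitVec μ + unitVec ν by abel,
    show u - unitVec ν - unitVec μ = u - unitVec μ - unitVec ν by abel]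
  ring

/-- kernel: `Σ_ν (∂^{η*}_νW_ν)(u) = c²(B_μ(u)·HC(u) − C(u)·HB_μ(u))`. [cite: Balaban1983Higgs3, (2.26) p.431] -/
theorem sum_pdiffAdjZ_Wker (u : ZSite d) :
    ∑ ν : Fin d, pdiffAdjZ c ν (Wker c C μ ν) u =
      c ^ 2 * (pdiffAdjZ c μ C u * hop C u - C u * hop (pdiffAdjZ c μ C) u) := by
  simp only [pdiffAdjZ, Wker, hop, sub_add_cancel]
  rw [Finset.mul_sum, Finset.mul_sum, ← Finset.sum_sub_distrib, Finset.mul_sum]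
  refine Finset.sum_congr rfl fun ν _ => ?_
  ring

end Algebra

section LatticeEq

variable {η M2 : ℝ} {C : ZSite d → ℝ}

/-- kernel: the lattice equation `(−Δ^η + M²)C = δ^η` in nearest-neighbour form, `c²HC = (2dc² + M²)C − δ^η` (`c = η⁻¹`).
[cite: Balaban1983Higgs3, (2.23) p.430] -/
theorem hop_eq_of_latticeEq (hCeq : ∀ z, negLapZ η C z + M2 * C z = if z = 0 then η⁻¹ ^ d else 0) (u : ZSite d) :
    η⁻¹ ^ 2 * hop C u = (2 * d * η⁻¹ ^ 2 + M2) * C u - (if u = 0 then η⁻¹ ^ d else 0) := by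
  have h := hCeq u
  rw [negLapZ_eq_hop] at h
  linear_combination -h

/-- kernel: the lattice equation of `B_μ = ∂^{η*}_μC` in nearest-neighbour form,
`c²HB_μ = (2dc² + M²)B_μ − c(δ^η(· − e_μ) − δ^η)`. [cite: Balaban1983Higgs3, (2.23) p.430] -/
theorem hop_pdiffAdjZ_eq_of_latticeEq (hCeq : ∀ z, negLapZ η C z + M2 * C z = if z = 0 then η⁻¹ ^ d else 0)
    (μ : Fin d) (u : ZSite d) :
    η⁻¹ ^ 2 * hop (pdiffAdjZ η⁻¹ μ C) u = (2 * d * η⁻¹ ^ 2 + M2) * pdiffAdjZ η⁻¹ μ C u -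
      η⁻¹ * ((if u - unitVec μ = 0 then η⁻¹ ^ d else 0) - (if u = 0 then η⁻¹ ^ d else 0)) := by
  rw [hop_pdiffAdjZ]
  have h1 := hop_eq_of_latticeEq hCeq (u - unitVec μ)
  have h2 := hop_eq_of_latticeEq hCeq u
  simp only [pdiffAdjZ]
  linear_combination η⁻¹ * h1 - η⁻¹ * h2

/-- kernel: the `δ`-reduction — with both lattice equations, `c²(B_μ·HC − C·HB_μ)(u) = −B_μ(u)δ^η(u) + cC(u)δ^η(u − e_μ) −
cC(u)δ^η(u)`: only the sites `u = 0` and `u = e_μ` survive. [cite: Balaban1983Higgs3, (2.26) p.431] -/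
theorem delta_reduction (hCeq : ∀ z, negLapZ η C z + M2 * C z = if z = 0 then η⁻¹ ^ d else 0) (μ : Fin d)
    (u : ZSite d) :
    η⁻¹ ^ 2 * (pdiffAdjZ η⁻¹ μ C u * hop C u - C u * hop (pdiffAdjZ η⁻¹ μ C) u) =
      -(pdiffAdjZ η⁻¹ μ C u * (if u = 0 then η⁻¹ ^ d else 0)) +
        η⁻¹ * C u * (if u - unitVec μ = 0 then η⁻¹ ^ d else 0) - η⁻¹ * C u * (if u = 0 then η⁻¹ ^ d else 0) := by
  have h1 := hop_eq_of_latticeEq hCeq u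
  have h2 := hop_pdiffAdjZ_eq_of_latticeEq hCeq μ u
  linear_combination pdiffAdjZ η⁻¹ μ C u * h1 - C u * h2

end LatticeEq

/-! ## §5 (2.26) at free boundary conditions -/

section Main

variable {η M2 A : ℝ} {m : ℕ} {C lam : ZSite d → ℝ}

/-- kernel: the `wt1`-integrand after the change of variables is summable (each direction separately).
[cite: Balaban1983Higgs3, (2.26) p.431] -/
theorem summable_wt1_term (hC : Summable fun z => (1 + (l1 z : ℝ)) ^ m * |C z|)
    (hlam : ∀ z, |lam z| ≤ A * (1 + (l1 z : ℝ)) ^ m) (x : ZSite d) (μ ν : Fin d) :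
    Summable fun u => pdiffZ η⁻¹ ν C u * pdiffAdjZ η⁻¹ μ C u * pdiffZ η⁻¹ ν (fun v => lam (x + v)) u := by
  have h := fun a b e => summable_CC_lam hC hlam x a b e
  have key : ∀ u, pdiffZ η⁻¹ ν C u * pdiffAdjZ η⁻¹ μ C u * pdiffZ η⁻¹ ν (fun v => lam (x + v)) u =
      η⁻¹ ^ 3 * (C (u + unitVec ν) * C (u + -unitVec μ) * lam (x + u + unitVec ν)
        - C (u + unitVec ν) * C (u + -unitVec μ) * lam (x + u + 0)
        - C (u + unitVec ν) * C (u + 0) * lam (x + u + unitVec ν)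
        + C (u + unitVec ν) * C (u + 0) * lam (x + u + 0)
        - C (u + 0) * C (u + -unitVec μ) * lam (x + u + unitVec ν)
        + C (u + 0) * C (u + -unitVec μ) * lam (x + u + 0)
        + C (u + 0) * C (u + 0) * lam (x + u + unitVec ν)
        - C (u + 0) * C (u + 0) * lam (x + u + 0)) := by
    intro u
    simp only [pdiffZ, pdiffAdjZ, add_zero, ← sub_eq_add_neg, add_assoc]
    ring
  refine (Summable.mul_left (η⁻¹ ^ 3) ?_).congr fun u => (key u).symm
  exact ((((((((h _ _ _).sub (h _ _ _)).sub (h _ _ _)).add (h _ _ _)).sub (h _ _ _)).add (h _ _ _)).add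
    (h _ _ _)).sub (h _ _ _))

/-- kernel: the `wt2`-integrand after the change of variables is summable (each direction separately).
[cite: Balaban1983Higgs3, (2.26) p.431] -/
theorem summable_wt2_term (hC : Summable fun z => (1 + (l1 z : ℝ)) ^ m * |C z|)
    (hlam : ∀ z, |lam z| ≤ A * (1 + (l1 z : ℝ)) ^ m) (x : ZSite d) (μ ν : Fin d) :
    Summable fun u => C u * pdiffZ η⁻¹ ν (pdiffAdjZ η⁻¹ μ C) u * pdiffZ η⁻¹ ν (fun v => lam (x + v)) u := by
  have h := fun a b e => summable_CC_lam hC hlam x a b e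
  have key : ∀ u, C u * pdiffZ η⁻¹ ν (pdiffAdjZ η⁻¹ μ C) u * pdiffZ η⁻¹ ν (fun v => lam (x + v)) u =
      η⁻¹ ^ 3 * (C (u + 0) * C (u + (unitVec ν - unitVec μ)) * lam (x + u + unitVec ν)
        - C (u + 0) * C (u + (unitVec ν - unitVec μ)) * lam (x + u + 0)
        - C (u + 0) * C (u + unitVec ν) * lam (x + u + unitVec ν)
        + C (u + 0) * C (u + unitVec ν) * lam (x + u + 0)
        - C (u + 0) * C (u + -unitVec μ) * lam (x + u + unitVec ν)
        + C (u + 0) * C (u + -unitVec μ) * lam (x + u + 0)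
        + C (u + 0) * C (u + 0) * lam (x + u + unitVec ν)
        - C (u + 0) * C (u + 0) * lam (x + u + 0)) := by
    intro u
    simp only [pdiffZ, pdiffAdjZ, add_zero, ← sub_eq_add_neg, add_assoc, ← add_sub_assoc]
    ring
  refine (Summable.mul_left (η⁻¹ ^ 3) ?_).congr fun u => (key u).symm
  exact ((((((((h _ _ _).sub (h _ _ _)).sub (h _ _ _)).add (h _ _ _)).sub (h _ _ _)).add (h _ _ _)).add
    (h _ _ _)).sub (h _ _ _))

/-- kernel: `W_ν(u)Λ(u + e)` is summable for every translate `e`. [cite: Balaban1983Higgs3, (2.26) p.431] -/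
theorem summable_Wker_mul (hC : Summable fun z => (1 + (l1 z : ℝ)) ^ m * |C z|)
    (hlam : ∀ z, |lam z| ≤ A * (1 + (l1 z : ℝ)) ^ m) (x : ZSite d) (μ ν : Fin d) (e : ZSite d) :
    Summable fun u => Wker η⁻¹ C μ ν u * lam (x + u + e) := by
  have h := fun a b e => summable_CC_lam hC hlam x a b e
  have key : ∀ u, Wker η⁻¹ C μ ν u * lam (x + u + e) =
      η⁻¹ ^ 2 * (C (u + 0) * C (u + (unitVec ν - unitVec μ)) * lam (x + u + e)
        - C (u + 0) * C (u + unitVec ν) * lam (x + u + e)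
        - C (u + unitVec ν) * C (u + -unitVec μ) * lam (x + u + e)
        + C (u + unitVec ν) * C (u + 0) * lam (x + u + e)) := by
    intro u
    simp only [Wker, pdiffAdjZ, add_zero, ← sub_eq_add_neg, ← add_sub_assoc]
    ring
  refine (Summable.mul_left (η⁻¹ ^ 2) ?_).congr fun u => (key u).symm
  exact (((h _ _ _).sub (h _ _ _)).sub (h _ _ _)).add (h _ _ _)

/-- **`−wt1 + wt2` in the variable `u = b′₋ − x`**: `−wt1 + wt2 = Σ_u η^d Σ_ν W_ν(u)(∂_νΛ)(u)`, all sums absolutely convergent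
(evenness of `C`: `(C∂^{η*})(b₋,b′) = (∂_νC)(u)`, `C(b₋,b′₋) = C(u)`). [cite: Balaban1983Higgs3, (2.26) p.431] -/
theorem neg_wt1_add_wt2_eq (hCeven : ∀ z, C (-z) = C z)
    (hC : Summable fun z => (1 + (l1 z : ℝ)) ^ m * |C z|) (hlam : ∀ z, |lam z| ≤ A * (1 + (l1 z : ℝ)) ^ m)
    (x : ZSite d) (μ : Fin d) :
    -wt1 η C lam x μ + wt2 η C lam x μ =
      ∑' u, η ^ d * ∑ ν : Fin d, Wker η⁻¹ C μ ν u * pdiffZ η⁻¹ ν (fun v => lam (x + v)) u := by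
  set Λ : ZSite d → ℝ := fun v => lam (x + v) with hΛ
  -- the two integrands in the variable u
  set F1 : ZSite d → ℝ := fun u => η ^ d * ∑ ν : Fin d, pdiffZ η⁻¹ ν C u * pdiffAdjZ η⁻¹ μ C u * pdiffZ η⁻¹ ν Λ u
  set F2 : ZSite d → ℝ := fun u => η ^ d * ∑ ν : Fin d, C u * pdiffZ η⁻¹ ν (pdiffAdjZ η⁻¹ μ C) u * pdiffZ η⁻¹ ν Λ u
  have hF1 : Summable F1 := (summable_sum fun ν _ => summable_wt1_term hC hlam x μ ν).mul_left _
  have hF2 : Summable F2 := (summable_sum fun ν _ => summable_wt2_term hC hlam x μ ν).mul_left _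
  have h1 : wt1 η C lam x μ = ∑' u, F1 u := by
    rw [wt1, ← Equiv.tsum_eq (Equiv.addLeft x)]
    refine tsum_congr fun u => ?_
    simp only [Equiv.coe_addLeft, F1]
    congr 1
    refine Finset.sum_congr rfl fun ν _ => ?_
    rw [kerCDZ_left η⁻¹ C x hCeven, kerCDZ_right, pdiffZ_shift]
  have h2 : wt2 η C lam x μ = ∑' u, F2 u := by
    rw [wt2, ← Equiv.tsum_eq (Equiv.addLeft x)]
    refine tsum_congr fun u => ?_
    simp only [Equiv.coe_addLeft, F2]
    congr 1
    refine Finset.sum_congr rfl fun ν _ => ?_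
    rw [C_left C x hCeven, kerDCDZ_eq, pdiffZ_shift]
  rw [h1, h2, ← tsum_neg, ← (hF1.neg).tsum_add hF2]
  refine tsum_congr fun u => ?_
  simp only [F1, F2]
  rw [← mul_neg, ← mul_add, ← Finset.sum_neg_distrib, ← Finset.sum_add_distrib]
  congr 1
  refine Finset.sum_congr rfl fun ν _ => ?_
  rw [← integrand_eq_Wker]
  ring

/-- **the value of `−wt1 + wt2`**: summation by parts, `Σ_ν∂^*_νW_ν = c²(B_μHC − CHB_μ)`, and the two lattice equations leave
`−wt1 + wt2 = C(e_μ)·(∂^η_μλ)(x)`. [cite: Balaban1983Higgs3, (2.26) p.431] -/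
theorem neg_wt1_add_wt2_eq_local (hη : 0 < η) (hCeven : ∀ z, C (-z) = C z)
    (hCeq : ∀ z, negLapZ η C z + M2 * C z = if z = 0 then η⁻¹ ^ d else 0)
    (hC : Summable fun z => (1 + (l1 z : ℝ)) ^ m * |C z|) (hlam : ∀ z, |lam z| ≤ A * (1 + (l1 z : ℝ)) ^ m)
    (x : ZSite d) (μ : Fin d) :
    -wt1 η C lam x μ + wt2 η C lam x μ = C (unitVec μ) * pdiffZ η⁻¹ μ lam x := by
  have hη0 : η ≠ 0 := hη.ne'
  set Λ : ZSite d → ℝ := fun v => lam (x + v) with hΛ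
  rw [neg_wt1_add_wt2_eq hCeven hC hlam x μ]
  -- summability of W_ν against Λ and its translate
  have hW0 : ∀ ν, Summable fun u => η ^ d * Wker η⁻¹ C μ ν u * Λ u := fun ν => by
    have := (summable_Wker_mul (η := η) hC hlam x μ ν 0).mul_left (η ^ d)
    refine this.congr fun u => ?_
    simp only [hΛ, add_zero]; ring
  have hW1 : ∀ ν, Summable fun u => η ^ d * Wker η⁻¹ C μ ν u * Λ (u + unitVec ν) := fun ν => by
    have := (summable_Wker_mul (η := η) hC hlam x μ ν (unitVec ν)).mul_left (η ^ d)
    refine this.congr fun u => ?_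
    simp only [hΛ, add_assoc]; ring
  -- Step 1: pull the finite ν-sum out, integrate by parts in each direction, push it back in
  have step1 : ∑' u, η ^ d * ∑ ν : Fin d, Wker η⁻¹ C μ ν u * pdiffZ η⁻¹ ν Λ u =
      ∑' u, (∑ ν : Fin d, pdiffAdjZ η⁻¹ ν (fun v => η ^ d * Wker η⁻¹ C μ ν v) u) * Λ u := by
    have hs : ∀ ν ∈ Finset.univ, Summable fun u => (η ^ d * Wker η⁻¹ C μ ν u) * pdiffZ η⁻¹ ν Λ u := by
      intro ν _
      have := ((hW1 ν).sub (hW0 ν)).mul_left η⁻¹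
      refine this.congr fun u => ?_
      simp only [pdiffZ]; ring
    have hs' : ∀ ν ∈ Finset.univ, Summable fun u => pdiffAdjZ η⁻¹ ν (fun v => η ^ d * Wker η⁻¹ C μ ν v) u * Λ u := by
      intro ν _
      have h3 : Summable fun u => η ^ d * Wker η⁻¹ C μ ν (u - unitVec ν) * Λ u := by
        refine (Equiv.summable_iff (Equiv.addRight (unitVec ν))).mp ?_
        simpa only [Function.comp_def, Equiv.coe_addRight, add_sub_cancel_right] using hW1 ν
      have := (h3.sub (hW0 ν)).mul_left η⁻¹
      refine this.congr fun u => ?_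
      simp only [pdiffAdjZ]; ring
    calc ∑' u, η ^ d * ∑ ν : Fin d, Wker η⁻¹ C μ ν u * pdiffZ η⁻¹ ν Λ u
        = ∑' u, ∑ ν : Fin d, (η ^ d * Wker η⁻¹ C μ ν u) * pdiffZ η⁻¹ ν Λ u := by
          refine tsum_congr fun u => ?_
          rw [Finset.mul_sum]
          exact Finset.sum_congr rfl fun ν _ => by ring
      _ = ∑ ν : Fin d, ∑' u, (η ^ d * Wker η⁻¹ C μ ν u) * pdiffZ η⁻¹ ν Λ u := Summable.tsum_finsetSum hs
      _ = ∑ ν : Fin d, ∑' u, pdiffAdjZ η⁻¹ ν (fun v => η ^ d * Wker η⁻¹ C μ ν v) u * Λ u := by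
          refine Finset.sum_congr rfl fun ν _ => ?_
          exact tsum_mul_pdiffZ η⁻¹ ν (hW1 ν) (hW0 ν)
      _ = ∑' u, ∑ ν : Fin d, pdiffAdjZ η⁻¹ ν (fun v => η ^ d * Wker η⁻¹ C μ ν v) u * Λ u :=
          (Summable.tsum_finsetSum hs').symm
      _ = ∑' u, (∑ ν : Fin d, pdiffAdjZ η⁻¹ ν (fun v => η ^ d * Wker η⁻¹ C μ ν v) u) * Λ u :=
          tsum_congr fun u => by rw [Finset.sum_mul]
  rw [step1]
  -- Step 2: the pointwise δ-reduction
  have step2 : ∀ u, (∑ ν : Fin d, pdiffAdjZ η⁻¹ ν (fun v => η ^ d * Wker η⁻¹ C μ ν v) u) * Λ u =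
      (if u = 0 then -(pdiffAdjZ η⁻¹ μ C 0) * Λ 0 - η⁻¹ * C 0 * Λ 0 else 0) +
        (if u = unitVec μ then η⁻¹ * C (unitVec μ) * Λ (unitVec μ) else 0) := by
    intro u
    have hlin : ∑ ν : Fin d, pdiffAdjZ η⁻¹ ν (fun v => η ^ d * Wker η⁻¹ C μ ν v) u =
        η ^ d * ∑ ν : Fin d, pdiffAdjZ η⁻¹ ν (Wker η⁻¹ C μ ν) u := by
      rw [Finset.mul_sum]
      refine Finset.sum_congr rfl fun ν _ => ?_
      simp only [pdiffAdjZ]; ring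
    rw [hlin, sum_pdiffAdjZ_Wker, delta_reduction hCeq μ u]
    have hpow : η ^ d * η⁻¹ ^ d = 1 := by rw [← mul_pow, mul_inv_cancel₀ hη0, one_pow]
    by_cases hu0 : u = 0
    · subst hu0
      have hne : (0 : ZSite d) - unitVec μ ≠ 0 := by
        rw [zero_sub, neg_ne_zero]; exact unitVec_ne_zero μ
      have hne' : (0 : ZSite d) ≠ unitVec μ := fun h => unitVec_ne_zero μ h.symm
      simp only [if_true, if_neg hne, if_neg hne', mul_zero, add_zero]
      linear_combination (-(pdiffAdjZ η⁻¹ μ C 0) * Λ 0 - η⁻¹ * C 0 * Λ 0) * hpow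
    · by_cases hu1 : u = unitVec μ
      · subst hu1
        simp only [if_neg hu0, sub_self, if_true, mul_zero, neg_zero, zero_add, sub_zero]
        linear_combination (η⁻¹ * C (unitVec μ) * Λ (unitVec μ)) * hpow
      · have hne : u - unitVec μ ≠ 0 := fun h => hu1 (sub_eq_zero.mp h)
        simp only [if_neg hu0, if_neg hu1, if_neg hne, mul_zero, neg_zero, add_zero, sub_zero, zero_mul]
  rw [tsum_congr step2, Summable.tsum_add (summable_of_ne_finset_zero (s := {0}) (by
      intro u hu; rw [Finset.mem_singleton] at hu; exact if_neg hu))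
    (summable_of_ne_finset_zero (s := {unitVec μ}) (by
      intro u hu; rw [Finset.mem_singleton] at hu; exact if_neg hu)),
    tsum_ite_eq, tsum_ite_eq]
  -- Step 3: the local terms
  simp only [hΛ, pdiffAdjZ, pdiffZ, add_zero, zero_sub, hCeven]
  ring

/-- **`wt3 + wt4 = C(e_μ)·(∂^η_μλ)(x)`** (`C(0) + η·c(C(−e_μ) − C(0)) = C(e_μ)`). [cite: Balaban1983Higgs3, (2.26) p.431] -/
theorem wt3_add_wt4_eq (hη : 0 < η) (hCeven : ∀ z, C (-z) = C z) (x : ZSite d) (μ : Fin d) :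
    wt3 η C lam x μ + wt4 η C lam x μ = C (unitVec μ) * pdiffZ η⁻¹ μ lam x := by
  have hη0 : η ≠ 0 := hη.ne'
  simp only [wt3, wt4, kerCDZ]
  rw [show x - (x + unitVec μ) = -unitVec μ by abel, sub_self, hCeven]
  field_simp
  ring

/-- **(2.26) AT FREE BOUNDARY CONDITIONS, per bond** — p. 431: *"They hold for free boundary conditions also"*: on the infinite
lattice `ηℤ^d` (any `d`, `η > 0`), for every EVEN kernel `C` solving the lattice equation `(−Δ^η + M²)C = δ^η` with
`Σ_z(1 + |z|₁)^m|C(z)| < ∞`, and every test function with `|λ(z)| ≤ A(1 + |z|₁)^m`, the four printed terms of (2.26) at the bond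
`b = (x, μ)` satisfy `−wt1 + wt2 − wt3 − wt4 = 0` (proved directly by summation by parts; the print's limit of the periodic
identities is not replayed). [cite: Balaban1983Higgs3, (2.26) p.431] -/
theorem bracket226_eq_zero (hη : 0 < η) (hCeven : ∀ z, C (-z) = C z)
    (hCeq : ∀ z, negLapZ η C z + M2 * C z = if z = 0 then η⁻¹ ^ d else 0)
    (hC : Summable fun z => (1 + (l1 z : ℝ)) ^ m * |C z|) (hlam : ∀ z, |lam z| ≤ A * (1 + (l1 z : ℝ)) ^ m)
    (x : ZSite d) (μ : Fin d) :
    bracket226 η C lam x μ = 0 := by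
  have h1 := neg_wt1_add_wt2_eq_local hη hCeven hCeq hC hlam x μ
  have h2 := wt3_add_wt4_eq (lam := lam) hη hCeven x μ
  unfold bracket226
  linear_combination h1 - h2

/-- **(2.26) AT FREE BOUNDARY CONDITIONS, as displayed** — the four printed terms summed against a finitely supported external
vector leg `A_b` (`b = (x, μ)`, `x ∈ S`), with the printed factors `−e_k`, `η^d`, `τ = tr q²`
(`tr q(X)q(Y) = XY·tr q²` for the scalar kernels):
`−e_kΣ_{b,b′}η^{2d}A_b tr[q(C∂^{η*})(b₋,b′)q(C∂^{η*})(b′₋,b)](∂^ηλ)(b′) + e_kΣ_{b,b′}η^{2d}A_b tr[qC(b₋,b′₋)q(∂^ηC∂^{η*})(b′,b)](∂^ηλ)(b′)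
− e_kΣ_bη^dA_b(∂^ηλ)(b) tr q²C(0) − e_kΣ_bη^dηA_b(∂^ηλ)(b) tr q²(C∂^η)(b₋,b) = 0` on `ηℤ^d`.
[cite: Balaban1983Higgs3, (2.26) p.431] -/
theorem eq226_free (hη : 0 < η) (hCeven : ∀ z, C (-z) = C z)
    (hCeq : ∀ z, negLapZ η C z + M2 * C z = if z = 0 then η⁻¹ ^ d else 0)
    (hC : Summable fun z => (1 + (l1 z : ℝ)) ^ m * |C z|) (hlam : ∀ z, |lam z| ≤ A * (1 + (l1 z : ℝ)) ^ m)
    (e τ : ℝ) (Aleg : ZSite d → Fin d → ℝ) (S : Finset (ZSite d)) :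
    (-e * ∑ x ∈ S, ∑ μ : Fin d, η ^ d * Aleg x μ * (τ * wt1 η C lam x μ)) +
      (e * ∑ x ∈ S, ∑ μ : Fin d, η ^ d * Aleg x μ * (τ * wt2 η C lam x μ)) -
      (e * ∑ x ∈ S, ∑ μ : Fin d, η ^ d * Aleg x μ * (τ * wt3 η C lam x μ)) -
      (e * ∑ x ∈ S, ∑ μ : Fin d, η ^ d * Aleg x μ * (τ * wt4 η C lam x μ)) = 0 := by
  have key : ∀ x μ, -wt1 η C lam x μ + wt2 η C lam x μ - wt3 η C lam x μ - wt4 η C lam x μ = 0 :=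
    fun x μ => bracket226_eq_zero hη hCeven hCeq hC hlam x μ
  calc (-e * ∑ x ∈ S, ∑ μ : Fin d, η ^ d * Aleg x μ * (τ * wt1 η C lam x μ)) +
      (e * ∑ x ∈ S, ∑ μ : Fin d, η ^ d * Aleg x μ * (τ * wt2 η C lam x μ)) -
      (e * ∑ x ∈ S, ∑ μ : Fin d, η ^ d * Aleg x μ * (τ * wt3 η C lam x μ)) -
      (e * ∑ x ∈ S, ∑ μ : Fin d, η ^ d * Aleg x μ * (τ * wt4 η C lam x μ))
      = e * τ * ∑ x ∈ S, ∑ μ : Fin d, η ^ d * Aleg x μ *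
          (-wt1 η C lam x μ + wt2 η C lam x μ - wt3 η C lam x μ - wt4 η C lam x μ) := by
        simp only [Finset.mul_sum, ← Finset.sum_add_distrib, ← Finset.sum_sub_distrib]
        refine Finset.sum_congr rfl fun x _ => Finset.sum_congr rfl fun μ _ => ?_
        ring
    _ = 0 := by simp only [key, mul_zero, Finset.sum_const_zero]

/-- **absolute convergence of the first printed `b′`-sum of (2.26) on the infinite lattice** (in the printed variable `b′₋`).
[cite: Balaban1983Higgs3, (2.26) p.431] -/
theorem summable_wt1_integrand (hCeven : ∀ z, C (-z) = C z) (hC : Summable fun z => (1 + (l1 z : ℝ)) ^ m * |C z|)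
    (hlam : ∀ z, |lam z| ≤ A * (1 + (l1 z : ℝ)) ^ m) (x : ZSite d) (μ : Fin d) :
    Summable fun x' => η ^ d * ∑ ν : Fin d, kerCDZ η⁻¹ C x x' ν * kerCDZ η⁻¹ C x' x μ * pdiffZ η⁻¹ ν lam x' := by
  have h : Summable fun u => η ^ d * ∑ ν : Fin d,
      pdiffZ η⁻¹ ν C u * pdiffAdjZ η⁻¹ μ C u * pdiffZ η⁻¹ ν (fun v => lam (x + v)) u :=
    (summable_sum fun ν _ => summable_wt1_term hC hlam x μ ν).mul_left _
  refine (Equiv.summable_iff (Equiv.addLeft x)).mp (h.congr fun u => ?_)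
  simp only [Function.comp_def, Equiv.coe_addLeft]
  congr 1
  refine Finset.sum_congr rfl fun ν _ => ?_
  rw [kerCDZ_left η⁻¹ C x hCeven, kerCDZ_right, pdiffZ_shift]

/-- **absolute convergence of the second printed `b′`-sum of (2.26) on the infinite lattice** (in the printed variable `b′₋`).
[cite: Balaban1983Higgs3, (2.26) p.431] -/
theorem summable_wt2_integrand (hCeven : ∀ z, C (-z) = C z) (hC : Summable fun z => (1 + (l1 z : ℝ)) ^ m * |C z|)
    (hlam : ∀ z, |lam z| ≤ A * (1 + (l1 z : ℝ)) ^ m) (x : ZSite d) (μ : Fin d) :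
    Summable fun x' => η ^ d * ∑ ν : Fin d, C (x - x') * kerDCDZ η⁻¹ C x' ν x μ * pdiffZ η⁻¹ ν lam x' := by
  have h : Summable fun u => η ^ d * ∑ ν : Fin d,
      C u * pdiffZ η⁻¹ ν (pdiffAdjZ η⁻¹ μ C) u * pdiffZ η⁻¹ ν (fun v => lam (x + v)) u :=
    (summable_sum fun ν _ => summable_wt2_term hC hlam x μ ν).mul_left _
  refine (Equiv.summable_iff (Equiv.addLeft x)).mp (h.congr fun u => ?_)
  simp only [Function.comp_def, Equiv.coe_addLeft]
  congr 1
  refine Finset.sum_congr rfl fun ν _ => ?_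
  rw [C_left C x hCeven, kerDCDZ_eq, pdiffZ_shift]

end Main

/-! ## §6 The propagators: `C^η_{M²}` on `ηℤ^d`, and (2.26) at free boundary conditions for them -/

section Propagators

/-- **C^η_{M²}** — the infinite-volume free propagator `(−Δ^η + M²)^{−1}` on `ηℤ^d` (free boundary conditions) as a kernel
with respect to `Σ_zη^d`, obtained from r15's momentum-integral propagator `C^ξ = (−Δ^ξ + 1)^{−1}` (`Cxi`) by the rescaling
`C^η_{M²} = M^{d−2}·C^{ηM}`, `M = √M²` (`−Δ^η + M² = M²(−Δ^{ηM} + 1)` on `ℤ^d`); `CetaM η 1 = Cxi η`.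
[cite: Balaban1983Higgs3, (2.26) p.431] -/
def CetaM (d : ℕ) (η M2 : ℝ) (z : ZSite d) : ℝ :=
  Real.sqrt M2 ^ d / M2 * Cxi d (η * Real.sqrt M2) z

variable {η M2 : ℝ}

/-- `C^η_1 = C^η` (r15's `Cxi`). [cite: Balaban1983Higgs3, (3.16) p.437] -/
theorem CetaM_one (d : ℕ) (η : ℝ) : CetaM d η 1 = Cxi d η := by
  funext z
  simp [CetaM, Real.sqrt_one]

/-- `C^η_{M²}` is even. [cite: Balaban1983Higgs3, (3.27) p.441] -/
theorem CetaM_neg (z : ZSite d) : CetaM d η M2 (-z) = CetaM d η M2 z := by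
  simp only [CetaM, Cxi_neg]

/-- `C^η_{M²} ≥ 0` (`M² > 0`, `η > 0`). [cite: Balaban1983Higgs3, (3.16) p.437] -/
theorem CetaM_nonneg (hη : 0 < η) (hM : 0 < M2) (z : ZSite d) : 0 ≤ CetaM d η M2 z := by
  have hs : 0 < Real.sqrt M2 := Real.sqrt_pos.mpr hM
  unfold CetaM
  exact mul_nonneg (by positivity) (Cxi_nonneg (mul_pos hη hs) z)

/-- kernel: `−Δ^η` is homogeneous. [cite: Balaban1983Higgs3, (2.26) p.431] -/
theorem negLapZ_const_mul (η s : ℝ) (f : ZSite d → ℝ) (z : ZSite d) :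
    negLapZ η (fun w => s * f w) z = s * negLapZ η f z := by
  simp only [negLapZ, Finset.mul_sum]
  exact Finset.sum_congr rfl fun μ _ => by ring

/-- kernel: `−Δ^η = M²·(−Δ^{ηM})` on `ℤ^d` (the spacing only enters through the prefactor `η^{−2}`). [cite: Balaban1983Higgs3, (2.26) p.431] -/
theorem negLapZ_rescale {η M : ℝ} (hη : η ≠ 0) (hM : M ≠ 0) (f : ZSite d → ℝ) (z : ZSite d) :
    negLapZ η f z = M ^ 2 * negLapZ (η * M) f z := by
  simp only [negLapZ, Finset.mul_sum]
  refine Finset.sum_congr rfl fun μ _ => ?_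
  rw [mul_inv, mul_pow]
  field_simp

/-- **THE LATTICE EQUATION OF `C^η_{M²}`**: `(−Δ^η + M²)C^η_{M²} = δ^η` on `ηℤ^d`, i.e.
`negLapZ η C^η_{M²}(z) + M²C^η_{M²}(z) = η^{−d}·[z = 0]` (from r15's `negLapZ_Cxi_add` at spacing `ηM`).
[cite: Balaban1983Higgs3, (2.23) p.430] -/
theorem negLapZ_CetaM_add (hη : 0 < η) (hM : 0 < M2) (z : ZSite d) :
    negLapZ η (CetaM d η M2) z + M2 * CetaM d η M2 z = if z = 0 then η⁻¹ ^ d else 0 := by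
  set M := Real.sqrt M2 with hMdef
  have hMpos : 0 < M := Real.sqrt_pos.mpr hM
  have hM2 : M ^ 2 = M2 := Real.sq_sqrt hM.le
  have hξ : 0 < η * M := mul_pos hη hMpos
  have h0 := negLapZ_Cxi_add (d := d) hξ z
  have h1 : negLapZ η (CetaM d η M2) z = M ^ d / M2 * (M ^ 2 * negLapZ (η * M) (Cxi d (η * M)) z) := by
    rw [show CetaM d η M2 = fun w => M ^ d / M2 * Cxi d (η * M) w from rfl, negLapZ_const_mul,
      negLapZ_rescale hη.ne' hMpos.ne']
  rw [h1, show CetaM d η M2 z = M ^ d / M2 * Cxi d (η * M) z from rfl]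
  have h2 : M ^ d / M2 * (M ^ 2 * negLapZ (η * M) (Cxi d (η * M)) z) + M2 * (M ^ d / M2 * Cxi d (η * M) z) =
      M ^ d * (negLapZ (η * M) (Cxi d (η * M)) z + Cxi d (η * M) z) := by
    rw [hM2]; field_simp
  rw [h2, h0]
  split_ifs
  · rw [mul_inv, mul_pow, ← mul_assoc, mul_comm (M ^ d), mul_assoc, ← mul_pow, mul_inv_cancel₀ hMpos.ne', one_pow,
      mul_one]
  · rw [mul_zero]

/-- **`C^η_{M²}` is summable with polynomial weights**: `Σ_z(1 + |z|₁)^m C^η_{M²}(z) < ∞` (r15's `summable_weight_Cxi`).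
[cite: Balaban1983Higgs3, (3.16) p.437] -/
theorem summable_weight_CetaM (hη : 0 < η) (hM : 0 < M2) (m : ℕ) :
    Summable fun z : ZSite d => (1 + (l1 z : ℝ)) ^ m * |CetaM d η M2 z| := by
  have hs : 0 < Real.sqrt M2 := Real.sqrt_pos.mpr hM
  have hξ : 0 < η * Real.sqrt M2 := mul_pos hη hs
  refine ((summable_weight_Cxi (d := d) hξ m).mul_left (Real.sqrt M2 ^ d / M2)).congr fun z => ?_
  rw [abs_of_nonneg (CetaM_nonneg hη hM z), CetaM]
  ring

/-- **`C^ξ` is summable with polynomial weights, absolute-value form** (r15's `summable_weight_Cxi`, `C^ξ ≥ 0`).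
[cite: Balaban1983Higgs3, (3.16) p.437] -/
theorem summable_weight_abs_Cxi {ξ : ℝ} (hξ : 0 < ξ) (m : ℕ) :
    Summable fun z : ZSite d => (1 + (l1 z : ℝ)) ^ m * |Cxi d ξ z| :=
  (summable_weight_Cxi (d := d) hξ m).congr fun z => by rw [abs_of_nonneg (Cxi_nonneg hξ z)]

/-- kernel: the lattice equation of `C^ξ` in the `M² = 1` form used by `bracket226_eq_zero`. [cite: Balaban1983Higgs3, (3.16) p.437] -/
theorem negLapZ_Cxi_add_one_mul {ξ : ℝ} (hξ : 0 < ξ) (z : ZSite d) :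
    negLapZ ξ (Cxi d ξ) z + 1 * Cxi d ξ z = if z = 0 then ξ⁻¹ ^ d else 0 := by
  rw [one_mul]; exact negLapZ_Cxi_add hξ z

variable {A : ℝ} {m : ℕ} {lam : ZSite d → ℝ}

/-- **(2.26) AT FREE BOUNDARY CONDITIONS FOR `C^η_{M²}`** — p. 431: *"They hold for free boundary conditions also"*: for every
`d`, `η > 0`, `M² > 0`, every bond `(x, μ)` of `ηℤ^d` and every test function with `|λ(z)| ≤ A(1 + |z|₁)^m`, the per-bond right
member of (2.26) with the infinite-volume propagator `C^η_{M²}` vanishes. [cite: Balaban1983Higgs3, (2.26) p.431] -/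
theorem bracket226_CetaM_eq_zero (hη : 0 < η) (hM : 0 < M2) (hlam : ∀ z, |lam z| ≤ A * (1 + (l1 z : ℝ)) ^ m)
    (x : ZSite d) (μ : Fin d) : bracket226 η (CetaM d η M2) lam x μ = 0 :=
  bracket226_eq_zero hη (fun z => CetaM_neg z) (negLapZ_CetaM_add hη hM) (summable_weight_CetaM hη hM m) hlam x μ

/-- **(2.26) AT FREE BOUNDARY CONDITIONS FOR `C^η_{M²}`, as displayed** (finitely supported external leg `A_b`, factors `−e_k`,
`η^d`, `tr q²`). [cite: Balaban1983Higgs3, (2.26) p.431] -/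
theorem eq226_free_CetaM (hη : 0 < η) (hM : 0 < M2) (hlam : ∀ z, |lam z| ≤ A * (1 + (l1 z : ℝ)) ^ m)
    (e τ : ℝ) (Aleg : ZSite d → Fin d → ℝ) (S : Finset (ZSite d)) :
    (-e * ∑ x ∈ S, ∑ μ : Fin d, η ^ d * Aleg x μ * (τ * wt1 η (CetaM d η M2) lam x μ)) +
      (e * ∑ x ∈ S, ∑ μ : Fin d, η ^ d * Aleg x μ * (τ * wt2 η (CetaM d η M2) lam x μ)) -
      (e * ∑ x ∈ S, ∑ μ : Fin d, η ^ d * Aleg x μ * (τ * wt3 η (CetaM d η M2) lam x μ)) -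
      (e * ∑ x ∈ S, ∑ μ : Fin d, η ^ d * Aleg x μ * (τ * wt4 η (CetaM d η M2) lam x μ)) = 0 :=
  eq226_free hη (fun z => CetaM_neg z) (negLapZ_CetaM_add hη hM) (summable_weight_CetaM hη hM m) hlam e τ Aleg S

/-- **(2.26) with `M² = 1` at free boundary conditions** for r15's `C^ξ` on `ξℤ^d` (the propagator of p. 437/(3.29)).
[cite: Balaban1983Higgs3, (2.26) p.431] -/
theorem bracket226_Cxi_eq_zero {ξ : ℝ} (hξ : 0 < ξ) (hlam : ∀ z, |lam z| ≤ A * (1 + (l1 z : ℝ)) ^ m)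
    (x : ZSite d) (μ : Fin d) : bracket226 ξ (Cxi d ξ) lam x μ = 0 :=
  bracket226_eq_zero hξ (Cxi_neg ξ) (negLapZ_Cxi_add_one_mul hξ) (summable_weight_abs_Cxi hξ m) hlam x μ

end Propagators

/-! ## §7 The p. 442 route: the square bracket of (3.29) "has exactly the form appearing in (2.26) with M² = 1, hence it is 0" -/

section Route442

variable {ξ : ℝ}

/-- kernel: for the LINEAR test function `λ(y′) = ξ·y′_{μ′}` of p. 442 (one component of
`λ(y′) = Σ_{μ′}g′(y)A′_{μ′}(y)(y′_{μ′} − y_{μ′})`, up to the `y′`-independent factor and an additive constant),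
`(∂^ξ_νλ)(y′) = δ_{νμ′}` — p. 442: *"then (∂^ξ_{μ′}λ)(y′) = g′(y)A′_{μ′}(y)"*. [cite: Balaban1983Higgs3, (3.29) p.441] -/
theorem pdiffZ_linear (hξ : ξ ≠ 0) (ν μ' : Fin d) (y' : ZSite d) :
    pdiffZ ξ⁻¹ ν (fun z : ZSite d => ξ * (z μ' : ℝ)) y' = if μ' = ν then 1 else 0 := by
  simp only [pdiffZ, Pi.add_apply, unitVec_apply, Int.cast_add, Int.cast_ite, Int.cast_one, Int.cast_zero]
  split_ifs <;> field_simp <;> ring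

/-- kernel: the linear test function has linear growth, `|ξy′_{μ′}| ≤ |ξ|(1 + |y′|₁)`. [cite: Balaban1983Higgs3, (2.26) p.431] -/
theorem abs_linear_le (ξ : ℝ) (μ' : Fin d) (z : ZSite d) :
    |ξ * (z μ' : ℝ)| ≤ |ξ| * (1 + (l1 z : ℝ)) ^ 1 := by
  rw [abs_mul, pow_one]
  refine mul_le_mul_of_nonneg_left ?_ (abs_nonneg _)
  linarith [abs_coord_le_l1 z μ']

variable {C : ZSite d → ℝ}

/-- **p20's kernel `Π^{(ξ)}_{μμ′}(y)` of the square bracket of (3.29) IS the per-bond right member of (2.26)** at the bond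
`(y, μ)` with the linear test function `λ(y′) = ξ·y′_{μ′}`: `Pi2Z d ξ τ C μ μ′ y = τ·(−wt1 + wt2 − wt3 − wt4)` — p. 442:
*"the expression in the square bracket above has exactly the form appearing in the Ward-Takahashi identity (2.26)"* (for every
even, polynomially-weighted summable `C`; the `y′`-sums converge absolutely). [cite: Balaban1983Higgs3, (3.29) p.441] -/
theorem Pi2Z_eq_bracket226 (hξ : 0 < ξ) (hCeven : ∀ z, C (-z) = C z)
    (hC : Summable fun z => (1 + (l1 z : ℝ)) ^ 1 * |C z|) (τ : ℝ) (μ μ' : Fin d) (y : ZSite d) :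
    Pi2Z d ξ τ C μ μ' y = τ * bracket226 ξ C (fun z : ZSite d => ξ * (z μ' : ℝ)) y μ := by
  have hξ0 : ξ ≠ 0 := hξ.ne'
  set lam : ZSite d → ℝ := fun z => ξ * (z μ' : ℝ) with hlamdef
  have hlam : ∀ z, |lam z| ≤ |ξ| * (1 + (l1 z : ℝ)) ^ 1 := fun z => abs_linear_le ξ μ' z
  have hδ : ∀ ν y', pdiffZ ξ⁻¹ ν lam y' = if μ' = ν then 1 else 0 := fun ν y' => pdiffZ_linear hξ0 ν μ' y'
  -- the two nonlocal integrands, termwise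
  have ha : ∀ y', ξ ^ d * ∑ ν : Fin d, kerCDZ ξ⁻¹ C y y' ν * kerCDZ ξ⁻¹ C y' y μ * pdiffZ ξ⁻¹ ν lam y' =
      ξ ^ d * (pdiffAdjZ ξ⁻¹ μ' C (y - y') * pdiffAdjZ ξ⁻¹ μ C (y' - y)) := by
    intro y'
    simp only [hδ, mul_ite, mul_one, mul_zero, Finset.sum_ite_eq, Finset.mem_univ, if_true]
    congr 1
    simp only [kerCDZ, pdiffAdjZ]
    rw [show y - (y' + unitVec μ') = y - y' - unitVec μ' by abel, show y' - (y + unitVec μ) = y' - y - unitVec μ by abel]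
  have hb : ∀ y', ξ ^ d * ∑ ν : Fin d, C (y - y') * kerDCDZ ξ⁻¹ C y' ν y μ * pdiffZ ξ⁻¹ ν lam y' =
      ξ ^ d * (C (y - y') * pdiffZ ξ⁻¹ μ' (pdiffAdjZ ξ⁻¹ μ C) (y' - y)) := by
    intro y'
    simp only [hδ, mul_ite, mul_one, mul_zero, Finset.sum_ite_eq, Finset.mem_univ, if_true]
    congr 2
    have := kerDCDZ_eq ξ⁻¹ C y μ (y' - y) μ'
    rwa [add_sub_cancel] at this
  have hsa : Summable fun y' => ξ ^ d * (pdiffAdjZ ξ⁻¹ μ' C (y - y') * pdiffAdjZ ξ⁻¹ μ C (y' - y)) :=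
    (summable_wt1_integrand hCeven hC hlam y μ).congr ha
  have hsb : Summable fun y' => ξ ^ d * (C (y - y') * pdiffZ ξ⁻¹ μ' (pdiffAdjZ ξ⁻¹ μ C) (y' - y)) :=
    (summable_wt2_integrand hCeven hC hlam y μ).congr hb
  have h1 : wt1 ξ C lam y μ = ∑' y', ξ ^ d * (pdiffAdjZ ξ⁻¹ μ' C (y - y') * pdiffAdjZ ξ⁻¹ μ C (y' - y)) := by
    rw [wt1]; exact tsum_congr ha
  have h2 : wt2 ξ C lam y μ = ∑' y', ξ ^ d * (C (y - y') * pdiffZ ξ⁻¹ μ' (pdiffAdjZ ξ⁻¹ μ C) (y' - y)) := by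
    rw [wt2]; exact tsum_congr hb
  have h3 : wt3 ξ C lam y μ = if μ = μ' then C 0 else 0 := by
    rw [wt3, hδ]
    by_cases h : μ = μ'
    · rw [if_pos h, if_pos h.symm, one_mul]
    · rw [if_neg h, if_neg (Ne.symm h), zero_mul]
  have hk : kerCDZ ξ⁻¹ C y y μ = pdiffAdjZ ξ⁻¹ μ C 0 := by
    simp only [kerCDZ, pdiffAdjZ]
    rw [show y - (y + unitVec μ) = 0 - unitVec μ by abel, sub_self]
  have h4 : wt4 ξ C lam y μ = if μ = μ' then ξ * pdiffAdjZ ξ⁻¹ μ C 0 else 0 := by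
    rw [wt4, hδ, hk]
    by_cases h : μ = μ'
    · rw [if_pos h, if_pos h.symm]; ring
    · rw [if_neg h, if_neg (Ne.symm h)]; ring
  have hnonloc : ∑' y', ξ ^ d * (-(pdiffAdjZ ξ⁻¹ μ' C (y - y') * pdiffAdjZ ξ⁻¹ μ C (y' - y)) +
        C (y - y') * pdiffZ ξ⁻¹ μ' (pdiffAdjZ ξ⁻¹ μ C) (y' - y)) = -wt1 ξ C lam y μ + wt2 ξ C lam y μ := by
    rw [h1, h2, ← tsum_neg, ← hsa.neg.tsum_add hsb]
    exact tsum_congr fun y' => by ring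
  unfold Pi2Z bracket226
  rw [hnonloc, h3, h4]
  split_ifs <;> ring

/-- **`Π^{(ξ)}_{μμ′} = 0` BY THE WARD–TAKAHASHI IDENTITY (2.26)** — p. 442: *"… has exactly the form appearing in the
Ward-Takahashi identity (2.26) with M² = 1, hence it is equal to 0"*, for EVERY even kernel `C` on `ξℤ^d` solving
`(−Δ^ξ + M²)C = δ^ξ` (any real `M²`) with `Σ_z(1 + |z|₁)|C(z)| < ∞`. [cite: Balaban1983Higgs3, (3.29) p.441] -/
theorem Pi2Z_eq_zero_of_latticeEq {M2 : ℝ} (hξ : 0 < ξ) (hCeven : ∀ z, C (-z) = C z)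
    (hCeq : ∀ z, negLapZ ξ C z + M2 * C z = if z = 0 then ξ⁻¹ ^ d else 0)
    (hC : Summable fun z => (1 + (l1 z : ℝ)) ^ 1 * |C z|) (τ : ℝ) (μ μ' : Fin d) (y : ZSite d) :
    Pi2Z d ξ τ C μ μ' y = 0 := by
  rw [Pi2Z_eq_bracket226 hξ hCeven hC,
    bracket226_eq_zero hξ hCeven hCeq hC (fun z => abs_linear_le ξ μ' z) y μ, mul_zero]

/-- **the square bracket of (3.29) vanishes** for every such `C` and all legs `g, g′, A, A′` (p20's `bracket329Z`).
[cite: Balaban1983Higgs3, (3.29) p.441] -/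
theorem bracket329Z_eq_zero_of_latticeEq {M2 : ℝ} (hξ : 0 < ξ) (hCeven : ∀ z, C (-z) = C z)
    (hCeq : ∀ z, negLapZ ξ C z + M2 * C z = if z = 0 then ξ⁻¹ ^ d else 0)
    (hC : Summable fun z => (1 + (l1 z : ℝ)) ^ 1 * |C z|) (τ : ℝ) (g g' : ZSite d → ℝ) (A A' : ZSite d → Fin d → ℝ) :
    bracket329Z d ξ τ C g g' A A' = 0 := by
  unfold bracket329Z
  simp only [Pi2Z_eq_zero_of_latticeEq hξ hCeven hCeq hC, mul_zero, zero_mul, Finset.sum_const_zero, tsum_zero]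

/-- **`Π^{(ξ)}_{μμ′}[C^ξ_{M²}] = 0`** for the infinite-volume propagator of any mass `M² > 0` on `ξℤ^d`, by (2.26) at free boundary
conditions. [cite: Balaban1983Higgs3, (3.29) p.441] -/
theorem Pi2Z_CetaM_eq_zero {M2 : ℝ} (hξ : 0 < ξ) (hM : 0 < M2) (τ : ℝ) (μ μ' : Fin d) (y : ZSite d) :
    Pi2Z d ξ τ (CetaM d ξ M2) μ μ' y = 0 :=
  Pi2Z_eq_zero_of_latticeEq hξ (fun z => CetaM_neg z) (negLapZ_CetaM_add hξ hM) (summable_weight_CetaM hξ hM 1) τ μ μ' y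

/-- **THE p. 442 SENTENCE BY ITS PRINTED ROUTE** — *"the expression in the square bracket above has exactly the form appearing
in the Ward-Takahashi identity (2.26) with M² = 1, hence it is equal to 0"*: `Π^{(ξ)}_{μμ′}[C^ξ](y) = 0` on `ξℤ^d` for every
`ξ > 0`, `μ, μ′, y, τ = tr q²` — a second, independent proof of p20's `B3Eq329WardVanishing.Pi2Z_Cxi_eq_zero` (Parseval on `T^d`
there; the position-space identity (2.26) at free boundary conditions here). [cite: Balaban1983Higgs3, (3.29) p.441] -/
theorem Pi2Z_Cxi_eq_zero_via226 (hξ : 0 < ξ) (τ : ℝ) (μ μ' : Fin d) (y : ZSite d) :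
    Pi2Z d ξ τ (Cxi d ξ) μ μ' y = 0 :=
  Pi2Z_eq_zero_of_latticeEq hξ (Cxi_neg ξ) (negLapZ_Cxi_add_one_mul hξ) (summable_weight_abs_Cxi hξ 1) τ μ μ' y

/-- **the square bracket of (3.29) is 0 for `C^ξ`** by the printed route (p20's `bracket329Z_Cxi_eq_zero` re-derived).
[cite: Balaban1983Higgs3, (3.29) p.441] -/
theorem bracket329Z_Cxi_eq_zero_via226 (hξ : 0 < ξ) (τ : ℝ) (g g' : ZSite d → ℝ) (A A' : ZSite d → Fin d → ℝ) :
    bracket329Z d ξ τ (Cxi d ξ) g g' A A' = 0 :=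
  bracket329Z_eq_zero_of_latticeEq hξ (Cxi_neg ξ) (negLapZ_Cxi_add_one_mul hξ) (summable_weight_abs_Cxi hξ 1) τ g g' A A'

end Route442

/-! ## §8 (v1.1, append-only) `C^η_{M²}` IS the printed momentum-integral propagator -/

section Integral

open _root_.MeasureTheory

variable {η M2 : ℝ}

/-- **`C^η_{M²}` is the infinite-volume momentum integral** `C^η_{M²}(z) = (2π)^{−d}∫_{|p_μ|≤π/η} cos(ηp·z)/(Δ^η(p) + M²) dp` — the
free propagator `(−Δ^η + M²)^{−1}` of the Gaussian measure `dμ_{C^η_{M²}}` of (2.23)–(2.26) at free boundary conditions (the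
definition `CetaM = M^{d−2}C^{ηM}` unfolded by the change of variables `p = p′/M` in r15's momentum integral `Cxi`; r15's
`integral_bzBox_comp_smul`, `lapSymbol_eq_smul`). [cite: Balaban1983Higgs3, (2.26) p.431] -/
theorem CetaM_eq_integral (hη : 0 < η) (hM : 0 < M2) (z : ZSite d) :
    CetaM d η M2 z = (2 * Real.pi)⁻¹ ^ d *
      ∫ p in bzBox d η, Real.cos (η * ∑ μ : Fin d, p μ * (z μ : ℝ)) / (lapSymbol d η p + M2) := by
  set M := Real.sqrt M2 with hMdef
  have hMpos : 0 < M := Real.sqrt_pos.mpr hM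
  have hM2 : M ^ 2 = M2 := Real.sq_sqrt hM.le
  have hξ : 0 < η * M := mul_pos hη hMpos
  -- both momentum integrals pulled back to the box |q_μ| ≤ π
  set g₂ : (Fin d → ℝ) → ℝ := fun q => Real.cos (∑ μ : Fin d, q μ * (z μ : ℝ)) / (η⁻¹ ^ 2 * lapSymbol d 1 q + M2)
    with hg₂
  have hphase : ∀ (s : ℝ) (p : Fin d → ℝ), s * ∑ μ : Fin d, p μ * (z μ : ℝ) = ∑ μ : Fin d, (s • p) μ * (z μ : ℝ) := by
    intro s p
    rw [Finset.mul_sum]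
    exact Finset.sum_congr rfl fun μ _ => by rw [Pi.smul_apply, smul_eq_mul, mul_assoc]
  have h1 : ∫ p in bzBox d (η * M), Real.cos ((η * M) * ∑ μ : Fin d, p μ * (z μ : ℝ)) / (lapSymbol d (η * M) p + 1) =
      ((η * M) ^ d)⁻¹ * (M2 * ∫ q in bzBox d 1, g₂ q) := by
    have hfun : (fun p : Fin d → ℝ => Real.cos ((η * M) * ∑ μ : Fin d, p μ * (z μ : ℝ)) / (lapSymbol d (η * M) p + 1)) =
        fun p => (fun q => M2 * g₂ q) ((η * M) • p) := by
      funext p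
      simp only [hg₂]
      rw [hphase (η * M) p, lapSymbol_eq_smul (η * M) p]
      have hL : 0 ≤ lapSymbol d 1 ((η * M) • p) := lapSymbol_nonneg d 1 _
      have hA : (η * M)⁻¹ ^ 2 * lapSymbol d 1 ((η * M) • p) + 1 ≠ 0 := by positivity
      have hB : η⁻¹ ^ 2 * lapSymbol d 1 ((η * M) • p) + M2 ≠ 0 := by positivity
      rw [← hM2, mul_inv, mul_pow]
      rw [← hM2] at hB
      field_simp
    rw [hfun, integral_bzBox_comp_smul hξ (fun q => M2 * g₂ q), integral_const_mul]
  have h2 : ∫ p in bzBox d η, Real.cos (η * ∑ μ : Fin d, p μ * (z μ : ℝ)) / (lapSymbol d η p + M2) =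
      (η ^ d)⁻¹ * ∫ q in bzBox d 1, g₂ q := by
    have hfun : (fun p : Fin d → ℝ => Real.cos (η * ∑ μ : Fin d, p μ * (z μ : ℝ)) / (lapSymbol d η p + M2)) =
        fun p => g₂ (η • p) := by
      funext p
      simp only [hg₂]
      rw [hphase η p, lapSymbol_eq_smul η p]
    rw [hfun, integral_bzBox_comp_smul hη g₂]
  rw [h2, CetaM, Cxi, ← hMdef, h1, mul_pow, mul_inv]
  have hMd : M ^ d ≠ 0 := pow_ne_zero _ hMpos.ne'
  have hηd : η ^ d ≠ 0 := pow_ne_zero _ hη.ne'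
  field_simp

end Integral

end

end Literature.MathematicalPhysics.QuantumFieldTheory.Balaban1983to89.B3WT226FreeLattice
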